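import Literature.NumberTheory.LFunctions.RayClassLFunctionExceptionalZero
import Literature.NumberTheory.LFunctions.RayClassLogFreeTheorem14
import Literature.NumberTheory.LFunctions.RayClassXi
import Literature.NumberTheory.LFunctions.RayClassLSeriesWindows
import Literature.NumberTheory.LFunctions.DedekindZeta1LogFreeTheorem14AllDegrees
import Literature.NumberTheory.LFunctions.DedekindZetaExplicitFormula
import Literature.NumberTheory.LFunctions.UniformClassGroupPNTGeneralDegreeInputs
import HarnessLib

/-!
# The family of Hecke `L`-functions of a congruence class group `mod 𝔪`: size parameter, windows, the
# exceptional segment, and the log-free density bound in `Q`-form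

Topic `Literature/NumberTheory/LFunctions`, namespace `Literature.NumberTheory.LFunctions.AbelianDensity`; the ray-class
counterpart of the family package of the tree's `UniformClassGroupZeroSum.lean` / `…ClassPNTFamilyDensity` (class group,
conductor `1`).  Everything here is PROVED; `rayCondQ`, `rayFamF`, `rayExcRegion` are glue definitions.

For an abelian Frobenius datum `f : 𝔭 ↦ f 𝔭 ∈ G` killing the narrow ray `mod 𝔪 ≠ 0` whose non-trivial characters are
non-principal off `𝔪` (a congruence class group `H ⊇ P^𝔪`, `G = J^𝔪/H`):
* `rayCondQ K 𝔪 = Q_𝔪 = |d_K| n_K^{n_K} N𝔪` (Thorner–Zaman's `D_K 𝒬 n_K^{n_K}` for the class field of `H`, up to the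
  harmless replacement of the conductor by the modulus), `Q_𝔪 ≥ 12` for `n_K > 1`;
* `rayFamF … ψ` — the family `F_0 = ζ₁_K`, `F_ψ = L_ψ` (`datumData`, the entire Hecke `L`-function of the primitive
  associate of `ψ ∘ f`), entire, `≠ 0` at `2`, with the window bound
  `Σ_{|γ−τ|≤1/2} m ≤ 512(n+1)((log(|d_K|N𝔪) + 3n) + log(|τ|+4))` (`rayFam_window`);
* `rayExcRegion c K 𝔪` — the real segment `Im ρ = 0`, `Re ρ > 1 − c/(log(|d_K|N𝔪) + log 4)` of the Landau–Page package
  `exists_exceptionalZero_congruence_const`, and `re_le_of_not_rayExcRegion` — off it every zero of the family obeys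
  `β ≤ 1 − c/(log(|d_K|N𝔪) + log(|γ|+4))`;
* `rayFam_density (n) (hn) (A)` — the log-free density bound of the family in `Q`-form: for `K` of degree `n > 1`,
  `κ_K ≥ Q_𝔪^{−A}`, `|G| ≤ Q_𝔪⁴`, `T ≥ 1`, `α ≤ 1`:
  `Σ_ψ Σ_{ρ ∈ u ψ, α ≤ β} m_ψ(ρ) ≤ D e^{b(max(A,4) log Q_𝔪 + log(T+4))(1−α)}`
  (`logFreeDensity_congruence_all` + `logFreeDensity_dedekindZeta₁_all` at `P = Q_𝔪^{max(A,4)}(T+2)`).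

## References
* [Weiss1983] A. Weiss, J. reine angew. Math. 338 (1983), Theorem 4.3, §6.
* [ThornerZaman2017] J. Thorner, A. Zaman, Algebra Number Theory 11 (2017), Theorem 3.2.
* [ThornerZaman2019] J. Thorner, A. Zaman, Algebra Number Theory 13 (2019), Theorem 3.1, §4.3.
-/

noncomputable section

open Complex Real Set Filter Topology NumberField IsDedekindDomain
open scoped NumberField nonZeroDivisors

namespace Literature.NumberTheory.LFunctions.AbelianDensity

open Literature.NumberTheory.LFunctions.NumberField Literature.NumberTheory.LFunctions.LogFreeLocal
  Literature.NumberTheory.LFunctions.LogFreeDensity Literature.NumberTheory.LFunctions.EntireEF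
open scoped Classical

variable {K : Type} [Field K] [NumberField K]
variable {G : Type} [CommGroup G] [Finite G] {𝔪 : Ideal (𝓞 K)} {f : HeightOneSpectrum (𝓞 K) → G}

/-! ### The size parameter `Q_𝔪 = |d_K| n^n N𝔪` -/

variable (K) in
/-- **`Q_𝔪 = |d_K| · n_K^{n_K} · N𝔪`** (`condQn K · N𝔪`). [cite: ThornerZaman2017, Theorem 3.2] -/
def rayCondQ (𝔪 : Ideal (𝓞 K)) : ℝ := ThornerZaman.condQn K * ((Ideal.absNorm 𝔪 : ℕ) : ℝ)

/-- `1 ≤ N𝔪` for `𝔪 ≠ 0`. [cite: ThornerZaman2017, Theorem 3.2] -/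
theorem one_le_absNorm_cast (h𝔪 : 𝔪 ≠ ⊥) : (1 : ℝ) ≤ ((Ideal.absNorm 𝔪 : ℕ) : ℝ) := by
  exact_mod_cast Nat.one_le_iff_ne_zero.mpr (by rwa [Ne, Ideal.absNorm_eq_zero_iff])

/-- `Q = condQn K ≤ Q_𝔪`. [cite: ThornerZaman2017, Theorem 3.2] -/
theorem condQn_le_rayCondQ (h𝔪 : 𝔪 ≠ ⊥) : ThornerZaman.condQn K ≤ rayCondQ K 𝔪 := by
  have h0 : 0 ≤ ThornerZaman.condQn K := by unfold ThornerZaman.condQn; positivity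
  have h1 := one_le_absNorm_cast h𝔪
  unfold rayCondQ; nlinarith

/-- `Q_𝔪 ≥ 12` for `n_K > 1`. [cite: ThornerZaman2017, Theorem 3.2] -/
theorem twelve_le_rayCondQ (hK : 1 < Module.finrank ℚ K) (h𝔪 : 𝔪 ≠ ⊥) : 12 ≤ rayCondQ K 𝔪 :=
  (ThornerZaman.twelve_le_condQn (K := K) hK).trans (condQn_le_rayCondQ h𝔪)

/-- `|d_K| N𝔪 ≤ Q_𝔪`. [cite: ThornerZaman2017, Theorem 3.2] -/
theorem discr_mul_absNorm_le_rayCondQ (𝔪 : Ideal (𝓞 K)) :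
    ((discr K).natAbs : ℝ) * ((Ideal.absNorm 𝔪 : ℕ) : ℝ) ≤ rayCondQ K 𝔪 := by
  unfold rayCondQ ThornerZaman.condQn
  rw [Nat.cast_natAbs, Int.cast_abs]
  have hn1 : (1 : ℝ) ≤ (Module.finrank ℚ K : ℝ) ^ Module.finrank ℚ K :=
    one_le_pow₀ (by exact_mod_cast Module.finrank_pos (R := ℚ) (M := K))
  have h0 : 0 ≤ |(discr K : ℝ)| * ((Ideal.absNorm 𝔪 : ℕ) : ℝ) := by positivity
  nlinarith

/-- `log(|d_K| N𝔪) ≤ log Q_𝔪`. [cite: ThornerZaman2017, Theorem 3.2] -/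
theorem log_discr_mul_absNorm_le (h𝔪 : 𝔪 ≠ ⊥) :
    Real.log (((discr K).natAbs : ℝ) * ((Ideal.absNorm 𝔪 : ℕ) : ℝ)) ≤ Real.log (rayCondQ K 𝔪) :=
  Real.log_le_log (by linarith [one_le_discr_mul_absNorm K h𝔪]) (discr_mul_absNorm_le_rayCondQ 𝔪)

/-- The window constant: `log(|d_K|N𝔪) + 3 n_K ≤ 4 Q_𝔪`. [cite: ThornerZaman2017, Theorem 3.2] -/
theorem windowConst_le_rayCondQ (h𝔪 : 𝔪 ≠ ⊥) :
    Real.log (((discr K).natAbs : ℝ) * ((Ideal.absNorm 𝔪 : ℕ) : ℝ)) + 3 * Module.finrank ℚ K ≤ 4 * rayCondQ K 𝔪 := by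
  have h1 := one_le_discr_mul_absNorm K h𝔪
  have hlog := Real.log_le_sub_one_of_pos (by linarith : (0 : ℝ) < ((discr K).natAbs : ℝ) * ((Ideal.absNorm 𝔪 : ℕ) : ℝ))
  have hn := (ThornerZaman.finrank_le_condQn (K := K)).trans (condQn_le_rayCondQ h𝔪)
  have hd := discr_mul_absNorm_le_rayCondQ (K := K) 𝔪
  linarith

/-! ### The family -/

/-- **The family of a congruence class group**: `F_0 = ζ₁_K`, `F_ψ = L_ψ` (`ψ ≠ 0`, the entire Hecke `L`-function of the
primitive associate of `ψ ∘ f`, `datumData`). [cite: Weiss1983, Theorem 4.3] -/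
def rayFamF (h𝔪 : 𝔪 ≠ ⊥) (hray : ArtinKillsRay 𝔪 f)
    (hsep : ∀ χ : AddChar (Additive G) ℂ, χ ≠ 0 →
      ∃ v : HeightOneSpectrum (𝓞 K), ¬ 𝔪 ≤ v.asIdeal ∧ χ (Additive.ofMul (f v)) ≠ 1)
    (ψ : AddChar (Additive G) ℂ) : ℂ → ℂ :=
  if hψ : ψ = 0 then dedekindZeta₁ K else (datumData h𝔪 hray hsep ψ hψ).L

section family

variable (h𝔪 : 𝔪 ≠ ⊥) (hray : ArtinKillsRay 𝔪 f)
  (hsep : ∀ χ : AddChar (Additive G) ℂ, χ ≠ 0 →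
    ∃ v : HeightOneSpectrum (𝓞 K), ¬ 𝔪 ≤ v.asIdeal ∧ χ (Additive.ofMul (f v)) ≠ 1)

/-- `F_0 = ζ₁_K`. [cite: Weiss1983, Theorem 4.3] -/
theorem rayFamF_zero : rayFamF h𝔪 hray hsep 0 = dedekindZeta₁ K := by
  simp [rayFamF]

/-- `F_ψ = L_ψ` for `ψ ≠ 0`. [cite: Weiss1983, Theorem 4.3] -/
theorem rayFamF_of_ne {ψ : AddChar (Additive G) ℂ} (hψ : ψ ≠ 0) :
    rayFamF h𝔪 hray hsep ψ = (datumData h𝔪 hray hsep ψ hψ).L := by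
  simp [rayFamF, hψ]

/-- `F_ψ = datumL ψ` for `ψ ≠ 0`. [cite: Weiss1983, Theorem 4.3] -/
theorem rayFamF_eq_datumL {ψ : AddChar (Additive G) ℂ} (hψ : ψ ≠ 0) :
    rayFamF h𝔪 hray hsep ψ = datumL h𝔪 hray hsep ψ := by
  rw [rayFamF_of_ne h𝔪 hray hsep hψ, datumL_eq h𝔪 hray hsep hψ]

omit [NumberField K] [Finite G] in
include hsep in
/-- Non-principality of `ψ ∘ f` off `𝔪` in the tree's shape. [cite: Weiss1983, Theorem 4.3] -/
theorem charFun_nontrivial {ψ : AddChar (Additive G) ℂ} (hψ : ψ ≠ 0) :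
    ∃ v : HeightOneSpectrum (𝓞 K), ¬ 𝔪 ≤ v.asIdeal ∧ charFun f ψ v ≠ 1 := hsep ψ hψ

/-- Every member is entire. [cite: Weiss1983, Theorem 4.3] -/
theorem differentiable_rayFamF (ψ : AddChar (Additive G) ℂ) : Differentiable ℂ (rayFamF h𝔪 hray hsep ψ) := by
  by_cases hψ : ψ = 0
  · subst hψ; rw [rayFamF_zero]; exact dedekindZeta₁_differentiable K
  · rw [rayFamF_of_ne h𝔪 hray hsep hψ]; exact (datumData h𝔪 hray hsep ψ hψ).differentiable

/-- Every member is non-zero at `2`. [cite: Weiss1983, Theorem 4.3] -/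
theorem rayFamF_two_ne_zero (ψ : AddChar (Additive G) ℂ) : rayFamF h𝔪 hray hsep ψ 2 ≠ 0 := by
  by_cases hψ : ψ = 0
  · subst hψ; rw [rayFamF_zero]; exact dedekindZeta₁_ne_zero_of_one_le_re (by norm_num)
  · rw [rayFamF_of_ne h𝔪 hray hsep hψ]
    exact (datumData h𝔪 hray hsep ψ hψ).L_ne_zero_of_one_le_re (charFun_nontrivial hsep hψ) (by norm_num)

/-- **The window bound of every member**: `Σ_{window} m ≤ 512(n+1)((log(|d_K|N𝔪) + 3n) + log(|τ| + 4))`.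
[cite: ThornerZaman2019, §4.3] -/
theorem rayFam_window (ψ : AddChar (Additive G) ℂ) (τ : ℝ) (P : Finset ℂ)
    (hP : ∀ ρ ∈ P, rayFamF h𝔪 hray hsep ψ ρ = 0 ∧ 0 < ρ.re ∧ ρ.re < 1 ∧ |ρ.im - τ| ≤ 1 / 2) :
    ∑ ρ ∈ P, (analyticOrderNatAt (rayFamF h𝔪 hray hsep ψ) ρ : ℝ) ≤
      (512 * (Module.finrank ℚ K + 1)) *
        ((Real.log (((discr K).natAbs : ℝ) * ((Ideal.absNorm 𝔪 : ℕ) : ℝ)) + 3 * Module.finrank ℚ K) +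
          Real.log (|τ| + 4)) := by
  have hn0 : (0 : ℝ) ≤ Module.finrank ℚ K := Nat.cast_nonneg _
  have hlog4 : 0 ≤ Real.log (|τ| + 4) := Real.log_nonneg (by linarith [abs_nonneg τ])
  have hd1 : (1 : ℝ) ≤ ((discr K).natAbs : ℝ) := by exact_mod_cast Int.natAbs_pos.mpr (discr_ne_zero K)
  have hm1 := one_le_absNorm_cast h𝔪
  have hLd0 : 0 ≤ Real.log ((discr K).natAbs : ℝ) := Real.log_nonneg hd1
  have hLQ0 : 0 ≤ Real.log (((discr K).natAbs : ℝ) * ((Ideal.absNorm 𝔪 : ℕ) : ℝ)) :=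
    Real.log_nonneg (one_le_discr_mul_absNorm K h𝔪)
  by_cases hψ : ψ = 0
  · subst hψ
    rw [rayFamF_zero] at hP ⊢
    have h := window_bound_dedekindZeta₁ τ P hP
    have hle : Real.log ((discr K).natAbs : ℝ) ≤ Real.log (((discr K).natAbs : ℝ) * ((Ideal.absNorm 𝔪 : ℕ) : ℝ)) :=
      Real.log_le_log (by linarith) (by nlinarith)
    refine h.trans ?_
    have h512 : (0 : ℝ) ≤ 512 * (Module.finrank ℚ K + 1) := by positivity
    nlinarith [mul_le_mul_of_nonneg_left hle h512]
  · set D := datumData h𝔪 hray hsep ψ hψ with hD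
    rw [rayFamF_of_ne h𝔪 hray hsep hψ] at hP ⊢
    have hnt := charFun_nontrivial hsep hψ
    have h := sum_window_continuation_le D.isRayClassCharacter D.isPrimitive D.isSignType D.ne_bot (D.nontrivial hnt)
      D.differentiable D.L_eq D.differentiable_Lconj (fun s hs ↦ D.Lconj_eq hs) τ P hP
    simp only [zeroOrder] at h
    -- `log(|d_K| N𝔣) ≤ log(|d_K| N𝔪)` and `log(|τ|+7) ≤ 1 + log(|τ|+4)`
    have hdisc : |(discr K : ℝ)| = ((discr K).natAbs : ℝ) := by rw [Nat.cast_natAbs, Int.cast_abs]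
    have hf1 : (1 : ℝ) ≤ ((Ideal.absNorm D.𝔣 : ℕ) : ℝ) := one_le_absNorm_cast D.ne_bot
    have hcond : Real.log (|(discr K : ℝ)| * (Ideal.absNorm D.𝔣 : ℝ)) ≤
        Real.log (((discr K).natAbs : ℝ) * ((Ideal.absNorm 𝔪 : ℕ) : ℝ)) := by
      rw [hdisc]
      exact Real.log_le_log (by nlinarith) (mul_le_mul_of_nonneg_left D.absNorm_le (by linarith))
    have h7 : Real.log (|τ| + 7) ≤ 1 + Real.log (|τ| + 4) := by
      have h2 : Real.log (|τ| + 7) ≤ Real.log (2 * (|τ| + 4)) :=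
        Real.log_le_log (by linarith [abs_nonneg τ]) (by linarith [abs_nonneg τ])
      rw [Real.log_mul (by norm_num) (by linarith [abs_nonneg τ])] at h2
      have hl2 : Real.log 2 ≤ 1 := by
        have := Real.log_two_lt_d9; linarith
      linarith
    refine h.trans ?_
    nlinarith [mul_le_mul_of_nonneg_left h7 hn0, mul_le_mul_of_nonneg_left hcond (by norm_num : (0:ℝ) ≤ 64),
      mul_nonneg hn0 hlog4, mul_nonneg hn0 hLQ0]

/-! ### The exceptional segment and the zero-free region off it -/

/-- The real segment of the Landau–Page package `mod 𝔪`: `Im ρ = 0` and `Re ρ > 1 − c/(log(|d_K|N𝔪) + log 4)`.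
[cite: ThornerZaman2019, Theorem 3.1] -/
def rayExcRegion (c : ℝ) (K : Type) [Field K] [NumberField K] (𝔪 : Ideal (𝓞 K)) (ρ : ℂ) : Prop :=
  ρ.im = 0 ∧ 1 - c / (Real.log (((discr K).natAbs : ℝ) * ((Ideal.absNorm 𝔪 : ℕ) : ℝ)) + Real.log 4) < ρ.re

/-- **Off the exceptional segment every zero of the family obeys the classical zero-free region**: with a constant
`c` for which clause (1) of the package `exists_exceptionalZero_congruence_const` holds (zeros of the family in the
region `Re ρ > 1 − c/(log(|d_K|N𝔪) + log(|Im ρ|+4))` are real), a zero `ρ` of `F_ψ` off `rayExcRegion c K 𝔪` has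
`Re ρ ≤ 1 − c/(log(|d_K|N𝔪) + log(|Im ρ| + 4))`. [cite: ThornerZaman2019, Theorem 3.1] -/
theorem re_le_of_not_rayExcRegion {c : ℝ}
    (hpack : ∀ (ψ : AddChar (Additive G) ℂ) (ρ : ℂ),
      (((ψ = 0 → dedekindZeta₁ K ρ = 0) ∧ (ψ ≠ 0 → datumL h𝔪 hray hsep ψ ρ = 0)) ∧
        1 - c / (Real.log (((discr K).natAbs : ℝ) * ((Ideal.absNorm 𝔪 : ℕ) : ℝ)) + Real.log (|ρ.im| + 4)) < ρ.re) →
      ρ.im = 0 ∧ ψ + ψ = 0)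
    (ψ : AddChar (Additive G) ℂ) {ρ : ℂ} (h0 : rayFamF h𝔪 hray hsep ψ ρ = 0) (hexc : ¬ rayExcRegion c K 𝔪 ρ) :
    ρ.re ≤ 1 - c / (Real.log (((discr K).natAbs : ℝ) * ((Ideal.absNorm 𝔪 : ℕ) : ℝ)) + Real.log (|ρ.im| + 4)) := by
  by_contra hgt
  rw [not_le] at hgt
  have hZ : ((ψ = 0 → dedekindZeta₁ K ρ = 0) ∧ (ψ ≠ 0 → datumL h𝔪 hray hsep ψ ρ = 0)) ∧
      1 - c / (Real.log (((discr K).natAbs : ℝ) * ((Ideal.absNorm 𝔪 : ℕ) : ℝ)) + Real.log (|ρ.im| + 4)) < ρ.re := by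
    refine ⟨⟨fun h1 ↦ ?_, fun h1 ↦ ?_⟩, hgt⟩
    · subst h1; rwa [rayFamF_zero] at h0
    · rwa [rayFamF_eq_datumL h𝔪 hray hsep h1] at h0
  have him := (hpack ψ ρ hZ).1
  apply hexc
  refine ⟨him, ?_⟩
  have := hZ.2
  rwa [him, abs_zero, zero_add] at this

end family

/-! ### The log-free density bound of the family in `Q`-form -/

omit [CommGroup G] [Finite G] in
/-- The size parameter `P = Q_𝔪^a (T + 2)` is admissible: `P ≥ 2`, `|d_K| ≤ P`, `N𝔪 ≤ P`, `h_K ≤ P`, `|G| ≤ P`,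
`P⁻¹ ≤ κ_K`, `T ≤ P`, for `a ≥ max A 4`, `κ_K ≥ Q_𝔪^{−A}`, `|G| ≤ Q_𝔪⁴`, `T ≥ 1`, `n_K > 1`.
[cite: ThornerZaman2017, Theorem 3.2] -/
theorem raySizeParam_admissible (hK : 1 < Module.finrank ℚ K) (h𝔪 : 𝔪 ≠ ⊥) {A a T : ℝ} (haA : A ≤ a) (ha4 : 4 ≤ a)
    (hT : 1 ≤ T) (hκ : rayCondQ K 𝔪 ^ (-A) ≤ dedekindZeta_residue K)
    (hG : (Nat.card G : ℝ) ≤ rayCondQ K 𝔪 ^ (4 : ℕ)) :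
    2 ≤ rayCondQ K 𝔪 ^ a * (T + 2) ∧
      ((discr K).natAbs : ℝ) ≤ rayCondQ K 𝔪 ^ a * (T + 2) ∧
      ((Ideal.absNorm 𝔪 : ℕ) : ℝ) ≤ rayCondQ K 𝔪 ^ a * (T + 2) ∧
      (Fintype.card (ClassGroup (𝓞 K)) : ℝ) ≤ rayCondQ K 𝔪 ^ a * (T + 2) ∧
      (Nat.card G : ℝ) ≤ rayCondQ K 𝔪 ^ a * (T + 2) ∧
      (rayCondQ K 𝔪 ^ a * (T + 2))⁻¹ ≤ dedekindZeta_residue K ∧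
      T ≤ rayCondQ K 𝔪 ^ a * (T + 2) := by
  set Q : ℝ := rayCondQ K 𝔪 with hQ
  have hQ12 : (12 : ℝ) ≤ Q := twelve_le_rayCondQ hK h𝔪
  have hQ1 : (1 : ℝ) ≤ Q := by linarith
  have hQa1 : (1 : ℝ) ≤ Q ^ a := Real.one_le_rpow hQ1 (by linarith)
  have hQ4a : Q ^ (4 : ℕ) ≤ Q ^ a := by
    rw [← Real.rpow_natCast]
    exact Real.rpow_le_rpow_of_exponent_le hQ1 (by exact_mod_cast ha4)
  have hQQa : Q ≤ Q ^ a := by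
    have : Q ^ (1 : ℝ) ≤ Q ^ a := Real.rpow_le_rpow_of_exponent_le hQ1 (by linarith)
    rwa [Real.rpow_one] at this
  have hP : Q ^ a ≤ Q ^ a * (T + 2) := by nlinarith
  have hdm := discr_mul_absNorm_le_rayCondQ (K := K) 𝔪
  have hd1 : (1 : ℝ) ≤ ((discr K).natAbs : ℝ) := by exact_mod_cast Int.natAbs_pos.mpr (discr_ne_zero K)
  have hm1 := one_le_absNorm_cast h𝔪
  have hd : ((discr K).natAbs : ℝ) ≤ Q := by rw [hQ]; nlinarith
  have hm : ((Ideal.absNorm 𝔪 : ℕ) : ℝ) ≤ Q := by rw [hQ]; nlinarith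
  have hh : (Fintype.card (ClassGroup (𝓞 K)) : ℝ) ≤ Q ^ (4 : ℕ) := by
    have h1 := ThornerZaman.classNumber_le_condQn_pow (K := K) hK
    have h2 := condQn_le_rayCondQ (K := K) h𝔪
    have h0 : 0 ≤ ThornerZaman.condQn K := by unfold ThornerZaman.condQn; positivity
    calc (Fintype.card (ClassGroup (𝓞 K)) : ℝ) = (classNumber K : ℝ) := rfl
      _ ≤ ThornerZaman.condQn K ^ (4 : ℕ) := h1
      _ ≤ Q ^ (4 : ℕ) := by rw [hQ]; exact pow_le_pow_left₀ h0 h2 4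
  have hκ' : (Q ^ a * (T + 2))⁻¹ ≤ dedekindZeta_residue K := by
    refine le_trans ?_ hκ
    rw [Real.rpow_neg (by linarith)]
    exact inv_anti₀ (Real.rpow_pos_of_pos (by linarith) _)
      ((Real.rpow_le_rpow_of_exponent_le hQ1 haA).trans hP)
  refine ⟨by linarith, hd.trans (hQQa.trans hP), hm.trans (hQQa.trans hP), hh.trans (hQ4a.trans hP),
    hG.trans (hQ4a.trans hP), hκ', by nlinarith⟩

/-- **Log-free zero density for the family of a congruence class group, in `Q`-form**: there are `b, D > 0`
(depending on `n, A`) such that for every number field `K` of degree `n > 1` and every datum with `κ_K ≥ Q_𝔪^{−A}`,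
`|G| ≤ Q_𝔪⁴`, every `T ≥ 1`, `α ≤ 1` and all finite sets `u ψ` of zeros of `F_ψ` with `1/4 ≤ β < 1`, `|γ| ≤ T`:
`Σ_ψ Σ_{ρ ∈ u ψ, α ≤ β} m_ψ(ρ) ≤ D · e^{b(max(A,4) log Q_𝔪 + log(T + 4))(1 − α)}`.
[cite: Weiss1983, Theorem 4.3] [cite: ThornerZaman2017, Theorem 3.2] -/
theorem rayFam_density (n : ℕ) (hn : 1 < n) (A : ℝ) : ∃ b D : ℝ, 0 < b ∧ 0 < D ∧
    ∀ (K : Type) [Field K] [NumberField K], Module.finrank ℚ K = n →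
    ∀ (G : Type) [CommGroup G] [Finite G] (𝔪 : Ideal (𝓞 K)) (f : HeightOneSpectrum (𝓞 K) → G)
      (h𝔪 : 𝔪 ≠ ⊥) (hray : ArtinKillsRay 𝔪 f)
      (hsep : ∀ χ : AddChar (Additive G) ℂ, χ ≠ 0 →
        ∃ v : HeightOneSpectrum (𝓞 K), ¬ 𝔪 ≤ v.asIdeal ∧ χ (Additive.ofMul (f v)) ≠ 1),
      rayCondQ K 𝔪 ^ (-A) ≤ dedekindZeta_residue K → (Nat.card G : ℝ) ≤ rayCondQ K 𝔪 ^ (4 : ℕ) →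
      ∀ (T : ℝ), 1 ≤ T → ∀ u : AddChar (Additive G) ℂ → Finset ℂ,
        (∀ ψ, ∀ ρ ∈ u ψ, rayFamF h𝔪 hray hsep ψ ρ = 0 ∧ 1 / 4 ≤ ρ.re ∧ ρ.re < 1 ∧ |ρ.im| ≤ T) →
        ∀ α : ℝ, α ≤ 1 →
          ∑ ψ, ∑ ρ ∈ u ψ with α ≤ ρ.re, (analyticOrderNatAt (rayFamF h𝔪 hray hsep ψ) ρ : ℝ) ≤
            D * Real.exp (b * (max A 4 * Real.log (rayCondQ K 𝔪) + Real.log (T + 4))) ^ (1 - α) := by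
  obtain ⟨c₁, C₁, hc₁, hC₁, hCG⟩ := logFreeDensity_congruence_all n
  obtain ⟨c₂, C₂, hc₂, hC₂, hZ1⟩ := logFreeDensity_dedekindZeta₁_all n
  refine ⟨max c₁ c₂, C₁ + C₂, by positivity, by positivity,
    fun K _ _ hKn G _ _ 𝔪 f h𝔪 hray hsep hκ hG T hT u hu α hα1 ↦ ?_⟩
  have hK : 1 < Module.finrank ℚ K := by rw [hKn]; exact hn
  set a : ℝ := max A 4 with ha
  set Q : ℝ := rayCondQ K 𝔪 with hQ
  have hQ12 : (12 : ℝ) ≤ Q := twelve_le_rayCondQ hK h𝔪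
  have hQ1 : (1 : ℝ) ≤ Q := by linarith
  set P : ℝ := Q ^ a * (T + 2) with hP
  obtain ⟨hP2, hdP, hmP, hhP, hGP, hκP, hTP⟩ :=
    raySizeParam_admissible (K := K) (G := G) hK h𝔪 (le_max_left A 4) (le_max_right A 4) hT hκ hG
  -- clamp `α` at `0`
  set α' : ℝ := max α 0 with hα'
  have hα'0 : 0 ≤ α' := le_max_right _ _
  have hα'1 : α' ≤ 1 := max_le hα1 zero_le_one
  have hfilter : ∀ ψ, (u ψ).filter (fun ρ ↦ α ≤ ρ.re) = (u ψ).filter (fun ρ ↦ α' ≤ ρ.re) := by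
    intro ψ
    refine Finset.filter_congr fun ρ hρ ↦ ?_
    have := (hu ψ ρ hρ).2.1
    rw [hα', max_le_iff]
    exact ⟨fun h ↦ ⟨h, by linarith⟩, fun h ↦ h.1⟩
  simp_rw [hfilter]
  -- the `ψ ≠ 0` part
  have hZ : ∀ ψ : AddChar (Additive G) ℂ, ψ ≠ 0 → ∀ ρ ∈ u ψ,
      datumL h𝔪 hray hsep ψ ρ = 0 ∧ 1 / 4 ≤ ρ.re ∧ ρ.re < 1 ∧ |ρ.im| ≤ P := by
    intro ψ hψ ρ hρ
    obtain ⟨h0, h14, h1, hT'⟩ := hu ψ ρ hρ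
    rw [rayFamF_eq_datumL h𝔪 hray hsep hψ] at h0
    exact ⟨h0, h14, h1, hT'.trans hTP⟩
  have hA := hCG K hKn.le G 𝔪 f h𝔪 hray hsep P hP2 hdP hmP hGP hκP u hZ α' hα'0 hα'1
  -- the `ζ_K` part
  have hZ0 : ∀ ρ ∈ u 0, dedekindZeta₁ K ρ = 0 ∧ 1 / 4 ≤ ρ.re ∧ ρ.re < 1 ∧ |ρ.im| ≤ P := by
    intro ρ hρ
    obtain ⟨h0, h14, h1, hT'⟩ := hu 0 ρ hρ
    rw [rayFamF_zero] at h0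
    exact ⟨h0, h14, h1, hT'.trans hTP⟩
  have hB := hZ1 K hKn P hP2 hdP hhP hκP (u 0) hZ0 α' hα'0 hα'1
  -- assemble: split `Σ_ψ` into `ψ = 0` and `ψ ≠ 0`
  rw [← Finset.sum_filter_add_sum_filter_not Finset.univ (fun ψ ↦ ψ = (0 : AddChar (Additive G) ℂ))]
  rw [Finset.filter_eq' Finset.univ (0 : AddChar (Additive G) ℂ), if_pos (Finset.mem_univ _), Finset.sum_singleton]
  have hA' : ∑ ψ ∈ Finset.univ.filter (fun ψ ↦ ¬ ψ = (0 : AddChar (Additive G) ℂ)),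
      ∑ ρ ∈ (u ψ).filter (fun ρ ↦ α' ≤ ρ.re), (analyticOrderNatAt (rayFamF h𝔪 hray hsep ψ) ρ : ℝ) ≤
        C₁ * P ^ (c₁ * (1 - α')) := by
    refine le_of_eq_of_le ?_ hA
    refine Finset.sum_congr rfl fun ψ hψ ↦ ?_
    rw [Finset.mem_filter] at hψ
    refine Finset.sum_congr rfl fun ρ _ ↦ ?_
    rw [rayFamF_eq_datumL h𝔪 hray hsep hψ.2]; rfl
  have hB' : ∑ ρ ∈ (u 0).filter (fun ρ ↦ α' ≤ ρ.re), (analyticOrderNatAt (rayFamF h𝔪 hray hsep 0) ρ : ℝ) ≤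
      C₂ * P ^ (c₂ * (1 - α')) := by
    refine le_of_eq_of_le (Finset.sum_congr rfl fun ρ _ ↦ ?_) hB
    rw [rayFamF_zero]; rfl
  -- `P^{c(1-α')} ≤ exp(b(a log Q + log(T+4)))^{1-α}`
  set B : ℝ := Real.exp (max c₁ c₂ * (a * Real.log Q + Real.log (T + 4))) with hBdef
  have hP1 : (1 : ℝ) ≤ P := by linarith
  have ha0 : 0 ≤ a := le_trans (by norm_num) (le_max_right A 4)
  have hQa0 : 0 < Q ^ a := Real.rpow_pos_of_pos (by linarith) _
  have hPexp : P ≤ Real.exp (a * Real.log Q + Real.log (T + 4)) := by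
    rw [Real.exp_add, Real.exp_log (by linarith), show a * Real.log Q = Real.log (Q ^ a) by
      rw [Real.log_rpow (by linarith)], Real.exp_log hQa0, hP]
    nlinarith
  have hpow : ∀ {c : ℝ}, 0 < c → c ≤ max c₁ c₂ → P ^ (c * (1 - α')) ≤ B ^ (1 - α) := by
    intro c hc hcm
    have h1α : 0 ≤ 1 - α' := by linarith
    have hαα : 1 - α' ≤ 1 - α := by rw [hα']; exact sub_le_sub_left (le_max_left _ _) _
    have hB1 : 1 ≤ B := Real.one_le_exp (by
      have : 0 ≤ Real.log Q := Real.log_nonneg hQ1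
      have : 0 ≤ Real.log (T + 4) := Real.log_nonneg (by linarith)
      positivity)
    calc P ^ (c * (1 - α')) = (P ^ c) ^ (1 - α') := by rw [Real.rpow_mul (by linarith)]
      _ ≤ (Real.exp (a * Real.log Q + Real.log (T + 4)) ^ (max c₁ c₂)) ^ (1 - α') := by
          refine Real.rpow_le_rpow (by positivity) ?_ h1α
          have hE1 : 1 ≤ Real.exp (a * Real.log Q + Real.log (T + 4)) := by linarith
          exact (Real.rpow_le_rpow (by linarith) hPexp hc.le).trans
            (Real.rpow_le_rpow_of_exponent_le hE1 hcm)
      _ = B ^ (1 - α') := by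
          rw [hBdef, ← Real.exp_mul]; ring_nf
      _ ≤ B ^ (1 - α) := Real.rpow_le_rpow_of_exponent_le hB1 hαα
  have h1 := hpow hc₁ (le_max_left _ _)
  have h2' := hpow hc₂ (le_max_right _ _)
  have hBpos : 0 ≤ B ^ (1 - α) := Real.rpow_nonneg (Real.exp_pos _).le _
  calc ∑ ρ ∈ (u 0).filter (fun ρ ↦ α' ≤ ρ.re), (analyticOrderNatAt (rayFamF h𝔪 hray hsep 0) ρ : ℝ) +
        ∑ ψ ∈ Finset.univ.filter (fun ψ ↦ ¬ ψ = (0 : AddChar (Additive G) ℂ)),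
          ∑ ρ ∈ (u ψ).filter (fun ρ ↦ α' ≤ ρ.re), (analyticOrderNatAt (rayFamF h𝔪 hray hsep ψ) ρ : ℝ)
      ≤ C₂ * P ^ (c₂ * (1 - α')) + C₁ * P ^ (c₁ * (1 - α')) := add_le_add hB' hA'
    _ ≤ C₂ * B ^ (1 - α) + C₁ * B ^ (1 - α) :=
        add_le_add (mul_le_mul_of_nonneg_left h2' hC₂.le) (mul_le_mul_of_nonneg_left h1 hC₁.le)
    _ = (C₁ + C₂) * B ^ (1 - α) := by ring

end Literature.NumberTheory.LFunctions.AbelianDensity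

end
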